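import Mathlib
import Literature.AlgebraicGeometry.Resolution.TranscendenceDefect
import Literature.AlgebraicGeometry.Resolution.LocalBlowup
import Literature.AlgebraicGeometry.Resolution.AbhyankarMonomialUniformization
import Summits.ResolutionOfSingularities.ResolutionOfSingularities.Theorems.RadicialJungCleanModelsAbhyankarKnafKuhlmann
import HarnessLib

/-!
# Route `RadicialJung`, crux `CleanModels` (stmt-15917), line `Sketch` rev 35, stub 7 `stub_cleanModelsDimGEFour`: the local-monomialization input
# `hMono` AT ABHYANKAR PLACES WITH SEPARABLE RESIDUE FIELD is Knaf–Kuhlmann 2005 Thm. 1.1 (with its monomiality clause), BY NAME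

Explicit-unit seat `decomp-res-hand-2` g3 (structural hand, stubs 5–7).  OURS; nothing here proves resolution in characteristic `p`.

`…DimOfLocalMonomialization.lean` (this seat, ✓) reduces stub 7 to `hMono_d ∧ hND_d ∧ hZ_d`, where `hMono_d` asks, for a finitely generated affine
model `A ⊆ O` regular of dimension `d` at the centre of the zero-dimensional valuation ring `O`, that every finite `Z ⊆ A` be monomialized along `O`
on a finitely generated refinement `A ⊆ A' ⊆ O` regular at the centre.  This file records that at ABHYANKAR places (transcendence defect `0`) whose
residue field is separable over the ground field — in particular at every zero-dimensional Abhyankar place over a PERFECT ground field — this is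
exactly the printed Knaf–Kuhlmann 2005 Thm. 1.1 with its «Moreover» clause, typed as the named fact
`Literature.AlgebraicGeometry.Resolution.KnafKuhlmann2005_Thm11_monomialForm` (hand-2 g2, ✓ p793207; its discharge from the tree's PROVED KK05
Thm. 3.4 / Cor. 2.2 / Perron Lemma 4.2 / Lemma 5.1 is in progress, seat decomp-res-hand-1 g3: ✓ `…KK05ValueBasis`, ✓ `…KK05PerronPositive`,
✓ `…KK05ToricCentre`), carried here as a hypothesis:

* `localMonomialization_of_knafKuhlmann` — `(hKK)` ⟹ the `hMono` conclusion for `A ⊆ O`, `Frac A = K`, `O` Abhyankar with `κ(O)/k` separable,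
  `Z ⊆ A` finite (no regularity, dimension or zero-dimensionality hypothesis is needed): apply the fact to `Z ∪` generators of `A`.
* `localMonomialization_of_knafKuhlmann_of_perfectField` — the same over a PERFECT ground field at a valuation ring all of whose centres above `A`
  are closed points (`κ(O)` is then algebraic over `k`, ✓ `Lens5TFrame.isAlgebraic_residueField_of_centres_maximal`, hence separable).

So, by name: `hMono_d` at Abhyankar places ⟸ KK05 (print, every `d`); ✓ `cleanLUAbh_of_knafKuhlmann` (hand-2 g2) =
✓ `cleanLUConcl_of_isMin_pthPowerApprox_of_monomialization` ∘ `localMonomialization_of_knafKuhlmann` ∘ Kuhlmann.  Structural bookkeeping, counted 0.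
-/

noncomputable section

set_option linter.dupNamespace false -- mandated namespace of this single-conjunct summit

open IsLocalRing AlgebraicGeometry CategoryTheory
open Literature.AlgebraicGeometry.Resolution

namespace Summit.ResolutionOfSingularities.ResolutionOfSingularities.Theorems.RadicialJung.CleanModels

/-- **Local monomialization at an Abhyankar place with separable residue field, from Knaf–Kuhlmann 2005 Thm. 1.1 (with monomiality).**  Let
`K ⊇ k`, `O` a valuation ring of `K` containing `k`, ABHYANKAR over `k` (transcendence defect `0`) with `κ(O)` separable over `k` (for
`k → O → κ(O)`), `A ⊆ O` a finitely generated `k`-subalgebra with `Frac A = K`, and `Z ⊆ A` finite.  Granted `KnafKuhlmann2005_Thm11_monomialForm`,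
there is a finitely generated `A ⊆ A' ⊆ O` whose local ring at the centre of `O` is regular, with a regular system of parameters `(aᵢ)_{i<e}`
(`e = dim`) in which every non-zero `z ∈ Z` is an `𝒪`-monomial `z = v ∏ aᵢ^{μᵢ}`, `v` a unit — the conclusion of the hypothesis `hMono` of
✓ `cleanModels_dim_of_localMonomialization` at this valuation.  Proof: the fact applied to `Z ∪` (generators of `A`).
[cite: KnafKuhlmann2005, Thm. 1.1] -/
theorem localMonomialization_of_knafKuhlmann (hKK : Literature.AlgebraicGeometry.Resolution.KnafKuhlmann2005_Thm11_monomialForm.{0, 0})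
    (k : Type) [Field k] (K : Type) [Field K] [Algebra k K]
    (O : ValuationSubring K) (A : Subalgebra k K) (hAO : A.toSubring ≤ O.toSubring) (hAfg : A.FG)
    (hfrac : IsFractionRing A K)
    (hk : ∀ c : k, algebraMap k K c ∈ O) (htd : transcendenceDefect k O hk = 0)
    (hsep : @Algebra.IsSeparable k (ResidueField O) _ _
      ((IsLocalRing.residue O).comp ((algebraMap k K).codRestrict O hk)).toAlgebra)
    (Z : Finset K) (hZ : ∀ z ∈ Z, z ∈ A) :
    ∃ (A' : Subalgebra k K), A'.toSubring ≤ O.toSubring ∧ A ≤ A' ∧ A'.FG ∧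
    ∃ (_ : IsRegularLocalRing (locAtCentre A'.toSubring O)) (e : ℕ) (a : Fin e → ↥(locAtCentre A'.toSubring O)),
      Ideal.span (Set.range a) = IsLocalRing.maximalIdeal ↥(locAtCentre A'.toSubring O) ∧
      ringKrullDim ↥(locAtCentre A'.toSubring O) = (e : WithBot ℕ∞) ∧
      ∀ z ∈ Z, z ≠ 0 → ∃ (v : ↥(locAtCentre A'.toSubring O)) (μ : Fin e → ℕ), IsUnit v ∧
        z = (v : K) * ∏ i, ((a i : ↥(locAtCentre A'.toSubring O)) : K) ^ (μ i) := by
  classical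
  obtain ⟨s₀, hs₀⟩ := hAfg
  -- Knaf–Kuhlmann with `Z ∪ generators of A`
  let Z' : Finset K := s₀ ∪ Z
  have hZ'O : ∀ z ∈ Z', z ∈ O := by
    intro z hz
    rcases Finset.mem_union.mp hz with hz | hz
    · exact hAO (hs₀ ▸ Algebra.subset_adjoin hz : z ∈ A)
    · exact hAO (hZ z hz)
  obtain ⟨A', hA'fg, hA'O, -, hZA', hreg, d, a, hspan, hdim, hmono⟩ :=
    hKK k K (intermediateField_top_fg A ⟨s₀, hs₀⟩ hfrac) O hk htd hsep Z' hZ'O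
  have hAA' : A ≤ A' := by
    rw [← hs₀, Algebra.adjoin_le_iff]
    intro z hz
    exact hZA' z (Finset.mem_union_left _ hz)
  exact ⟨A', hA'O, hAA', hA'fg, hreg, d, a, hspan, hdim, fun z hz hz0 => hmono z (Finset.mem_union_right _ hz) hz0⟩

/-- **Local monomialization at a zero-dimensional Abhyankar valuation over a PERFECT ground field, from Knaf–Kuhlmann 2005 Thm. 1.1 (with
monomiality)**: when every centre of `O` above `A` is a closed point, `κ(O)` is algebraic over `k`
(✓ `Lens5TFrame.isAlgebraic_residueField_of_centres_maximal`, Zariski's lemma), hence separable over a perfect `k`, and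
`localMonomialization_of_knafKuhlmann` applies.  This is the hypothesis `hMono_d` of ✓ `cleanModels_dim_of_localMonomialization` at the Abhyankar
valuations, every `d`, over perfect ground fields, modulo the printed fact only. [cite: KnafKuhlmann2005, Thm. 1.1] -/
theorem localMonomialization_of_knafKuhlmann_of_perfectField
    (hKK : Literature.AlgebraicGeometry.Resolution.KnafKuhlmann2005_Thm11_monomialForm.{0, 0})
    (k : Type) [Field k] [PerfectField k] (K : Type) [Field K] [Algebra k K]
    (O : ValuationSubring K) (A : Subalgebra k K) (hAO : A.toSubring ≤ O.toSubring) (hAfg : A.FG)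
    (hfrac : IsFractionRing A K)
    (hzd : ∀ (T : Subring K) (hT : T ≤ O.toSubring), A.toSubring ≤ T → (subringCentre T O hT).IsMaximal)
    (hk : ∀ c : k, algebraMap k K c ∈ O) (htd : transcendenceDefect k O hk = 0)
    (Z : Finset K) (hZ : ∀ z ∈ Z, z ∈ A) :
    ∃ (A' : Subalgebra k K), A'.toSubring ≤ O.toSubring ∧ A ≤ A' ∧ A'.FG ∧
    ∃ (_ : IsRegularLocalRing (locAtCentre A'.toSubring O)) (e : ℕ) (a : Fin e → ↥(locAtCentre A'.toSubring O)),
      Ideal.span (Set.range a) = IsLocalRing.maximalIdeal ↥(locAtCentre A'.toSubring O) ∧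
      ringKrullDim ↥(locAtCentre A'.toSubring O) = (e : WithBot ℕ∞) ∧
      ∀ z ∈ Z, z ≠ 0 → ∃ (v : ↥(locAtCentre A'.toSubring O)) (μ : Fin e → ℕ), IsUnit v ∧
        z = (v : K) * ∏ i, ((a i : ↥(locAtCentre A'.toSubring O)) : K) ^ (μ i) := by
  letI alg : Algebra k (ResidueField O) := ((IsLocalRing.residue O).comp ((algebraMap k K).codRestrict O hk)).toAlgebra
  have hcomp : ∀ (c : k) (h : algebraMap k K c ∈ O),
      algebraMap k (ResidueField O) c = IsLocalRing.residue O ⟨algebraMap k K c, h⟩ := fun c h => rfl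
  haveI : Algebra.IsAlgebraic k (ResidueField O) :=
    Summit.ResolutionOfSingularities.ResolutionOfSingularities.Theorems.RadicialJungCleanModels.Lens5TFrame.isAlgebraic_residueField_of_centres_maximal
      O A hAO hAfg hzd hcomp
  have hsep : Algebra.IsSeparable k (ResidueField O) := Algebra.IsAlgebraic.isSeparable_of_perfectField
  exact localMonomialization_of_knafKuhlmann hKK k K O A hAO hAfg hfrac hk htd hsep Z hZ

end Summit.ResolutionOfSingularities.ResolutionOfSingularities.Theorems.RadicialJung.CleanModels

end
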